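import Literature.Geometry.Riemannian.CanonicalNeighbourhoods
import Literature.Analysis.Calculus.AreaFormulaMultiplicity
import HarnessLib

/-!
# Constant-multiplicity comparison of integrals along a `k`-sheeted local injection

Stub `stub_multiplicityLintegral` of line `ancient-sphere-rigidity` (reshape r5) for the crux
`EntropyRung.SubcylindricalRecognition` (stmt-SmoothPoincare4-10869): the purely
measure-theoretic assembly step of the cone-point exclusion. A punctured cone chart
`(B_r ∖ 0)/Γ`, `|Γ| = k`, of a Bamler blow-down is transplanted into the closed 4-manifold `M` as
a `k`-to-1 local diffeomorphism `Φ` from an open Euclidean annulus `A`; integrals over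
`Φ(A) ⊆ M` must be compared with Euclidean integrals over `A`.

## What

GIVEN, as hypotheses, a two-sided comparison `c₁ · vol S ≤ Vol_g(Φ S) ≤ c₂ · vol S` for
measurable subsets `S` of open sets `U ⊆ A` on which `Φ` is injective (arbitrary constants
`c₁, c₂ ∈ ℝ≥0∞`), local injectivity of `Φ` on the open set `A`, openness of `Φ(A)` and
constant fibre cardinality `#(Φ⁻¹{Φ y} ∩ A) = k ≥ 1` (`Set.ncard`), we prove, for every
measurable `G : M → ℝ≥0∞`,

`c₁ ∫⁻_A G∘Φ d vol ≤ k ∫⁻_{Φ A} G dV_g ≤ c₂ ∫⁻_A G∘Φ d vol`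

(`stub_multiplicityLintegral`, the registered signature). The Riemannian volume
`g.riemVolume` enters only as an abstract measure on `M`; the whole argument is carried out for
an arbitrary continuous-on-`A` map `Φ : X → Y` from a Polish space with a measure `μ` to a
Hausdorff Borel space with a measure `ν` (`Multiplicity.lintegral_comp_le_and_le`).

## Proof

The area formula with constant multiplicity, assembled from the injective pieces (Federer 1969,
§3.2.3; Evans–Gariepy, Thm. 3.8/3.9, Step 8 of the proof):

1. `A` is second countable, so countably many open sets `V n ⊆ A` with `Φ` injective on `V n`
   cover `A` (Lindelöf, `TopologicalSpace.isOpen_sUnion_countable`); disjointify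
   (`disjointed`) into measurable, pairwise disjoint `S n ⊆ V n` with `⋃ S n = A`
   (`Multiplicity.exists_seq_injOn_pieces`).
2. On one piece, the push-forward `Φ_* (μ|S n)` and `ν|Φ(S n)` compare: for measurable `B ⊆ Y`,
   `ν(B ∩ Φ(S n)) = ν(Φ(Φ⁻¹B ∩ S n)) ∈ [c₁, c₂] · μ(Φ⁻¹B ∩ S n)` by the hypothesis applied to the
   measurable set `Φ⁻¹B ∩ S n ⊆ V n` (`Φ` is continuous on the measurable set `A`); integrating
   `G` gives `c₁ ∫⁻_{S n} G∘Φ dμ ≤ ∫⁻_{Φ(S n)} G dν ≤ c₂ ∫⁻_{S n} G∘Φ dμ`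
   (`Multiplicity.lintegral_image_piece_le`; `Measure.le_iff`, `lintegral_mono'`,
   `lintegral_map'`).
3. Summing over `n`: `∑ ∫⁻_{S n} G∘Φ = ∫⁻_A G∘Φ` (`lintegral_iUnion`), and
   `∑ ∫⁻_{Φ(S n)} G dν = ∫⁻ G · (∑ 𝟙_{Φ(S n)}) dν = k ∫⁻_{Φ A} G dν`, because the number of `n`
   with `x ∈ Φ(S n)` is the fibre cardinality `#(Φ⁻¹{x} ∩ A)`
   (`Literature.Analysis.Calculus.encard_preimage_inter_eq_tsum_indicator`), which is `k` on
   `Φ(A)` and `0` off it (`Multiplicity.tsum_lintegral_image_pieces`; the images `Φ(S n)` are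
   Borel by the Lusin–Souslin theorem `MeasurableSet.image_of_continuousOn_injOn`).

Edge cases `c₁, c₂ ∈ {0, ⊤}` need no separate treatment: everything is an inequality of
measures integrated against `G`.

## References

* H. Federer, *Geometric Measure Theory*, Springer 1969, Thm. 3.2.3, Cor. 3.2.5.
* L. C. Evans, R. F. Gariepy, *Measure Theory and Fine Properties of Functions*, revised ed.,
  CRC Press 2015, Thm. 3.8, Thm. 3.9.
-/

noncomputable section

open scoped Manifold ContDiff Topology ENNReal NNReal
open Set MeasureTheory Literature.Geometry.Lorentzian Literature.Geometry.Riemannian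

namespace Summit.SmoothPoincare4.SmoothPoincare4.Theorems.SubcylindricalRecognition.AncientSphereRigidity

namespace Multiplicity

/-- **Pieces of injectivity.** If every point of `A` has an open neighbourhood `U ⊆ A` on which
`Φ` is injective, then (second countability) there are countably many such open sets
`V n ⊆ A` and measurable, pairwise disjoint `S n ⊆ V n` with `⋃ S n = A` (Lindelöf property and
disjointification). [folklore] -/
theorem exists_seq_injOn_pieces {X : Type*} [TopologicalSpace X] [SecondCountableTopology X]
    [MeasurableSpace X] [OpensMeasurableSpace X] {Y : Type*} {Φ : X → Y} {A : Set X}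
    (hloc : ∀ y ∈ A, ∃ U : Set X, IsOpen U ∧ y ∈ U ∧ U ⊆ A ∧ InjOn Φ U) :
    ∃ V S : ℕ → Set X, (∀ n, IsOpen (V n)) ∧ (∀ n, V n ⊆ A) ∧ (∀ n, InjOn Φ (V n)) ∧
      (∀ n, S n ⊆ V n) ∧ (∀ n, MeasurableSet (S n)) ∧ Pairwise (Function.onFun Disjoint S) ∧
      ⋃ n, S n = A := by
  classical
  obtain ⟨T, hTc, hTG, hTU⟩ := TopologicalSpace.isOpen_sUnion_countable
    {U : Set X | IsOpen U ∧ U ⊆ A ∧ InjOn Φ U} (fun U hU ↦ hU.1)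
  have hAG : ⋃₀ {U : Set X | IsOpen U ∧ U ⊆ A ∧ InjOn Φ U} = A := by
    refine Subset.antisymm (sUnion_subset fun U hU ↦ hU.2.1) fun y hy ↦ ?_
    obtain ⟨U, hUo, hyU, hUA, hU⟩ := hloc y hy
    exact mem_sUnion_of_mem hyU ⟨hUo, hUA, hU⟩
  obtain ⟨V, hV⟩ := (hTc.insert ∅).exists_eq_range (insert_nonempty ∅ T)
  have hVmem : ∀ n, IsOpen (V n) ∧ V n ⊆ A ∧ InjOn Φ (V n) := by
    intro n
    have hn : V n ∈ insert ∅ T := by rw [hV]; exact mem_range_self n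
    rcases mem_insert_iff.mp hn with h | h
    · rw [h]; exact ⟨isOpen_empty, empty_subset _, injOn_empty Φ⟩
    · exact hTG h
  have hVU : ⋃ n, V n = A := by
    rw [← sUnion_range, ← hV, sUnion_insert, empty_union, hTU, hAG]
  refine ⟨V, disjointed V, fun n ↦ (hVmem n).1, fun n ↦ (hVmem n).2.1, fun n ↦ (hVmem n).2.2,
    disjointed_subset V, MeasurableSet.disjointed fun n ↦ (hVmem n).1.measurableSet,
    disjoint_disjointed V, ?_⟩
  rw [iUnion_disjointed, hVU]

/-- A map continuous on a measurable set `A` pulls measurable sets back to measurable subsets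
of `A`: `Φ⁻¹ B ∩ A` is measurable for measurable `B`. [folklore] -/
theorem measurableSet_preimage_inter_of_continuousOn {X : Type*} [TopologicalSpace X]
    [MeasurableSpace X] [OpensMeasurableSpace X] {Y : Type*} [TopologicalSpace Y]
    [MeasurableSpace Y] [BorelSpace Y] {Φ : X → Y} {A : Set X} (hΦ : ContinuousOn Φ A)
    (hA : MeasurableSet A) {B : Set Y} (hB : MeasurableSet B) : MeasurableSet (Φ ⁻¹' B ∩ A) := by
  have hm : MeasurableSet ((Subtype.val : A → X) ⁻¹' (Φ ⁻¹' B)) :=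
    (continuousOn_iff_continuous_restrict.1 hΦ).measurable hB
  simpa only [Subtype.image_preimage_coe, inter_comm] using hA.subtype_image hm

/-- **One injective piece.** If `S ⊆ U ⊆ A` is measurable, `Φ` is continuous on the measurable
set `A`, and `c₁ μ S' ≤ ν (Φ S') ≤ c₂ μ S'` for all measurable `S' ⊆ U`, then
`c₁ ∫⁻_S G∘Φ dμ ≤ ∫⁻_{Φ S} G dν ≤ c₂ ∫⁻_S G∘Φ dμ` for measurable `G ≥ 0`: the two measures
`Φ_*(μ|S)` and `ν|Φ(S)` compare on measurable sets `B`, since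
`B ∩ Φ(S) = Φ(Φ⁻¹B ∩ S)`. [folklore] -/
theorem lintegral_image_piece_le {X : Type*} [TopologicalSpace X] [MeasurableSpace X]
    [OpensMeasurableSpace X] {Y : Type*} [TopologicalSpace Y] [MeasurableSpace Y] [BorelSpace Y]
    (μ : Measure X) (ν : Measure Y) {Φ : X → Y} {A U S : Set X} {c₁ c₂ : ℝ≥0∞}
    (hA : MeasurableSet A) (hΦ : ContinuousOn Φ A) (hUA : U ⊆ A) (hSU : S ⊆ U)
    (hS : MeasurableSet S)
    (hcomp : ∀ S' ⊆ U, MeasurableSet S' → c₁ * μ S' ≤ ν (Φ '' S') ∧ ν (Φ '' S') ≤ c₂ * μ S')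
    {G : Y → ℝ≥0∞} (hG : Measurable G) :
    c₁ * ∫⁻ y in S, G (Φ y) ∂μ ≤ ∫⁻ x in Φ '' S, G x ∂ν ∧
      ∫⁻ x in Φ '' S, G x ∂ν ≤ c₂ * ∫⁻ y in S, G (Φ y) ∂μ := by
  have hSA : S ⊆ A := hSU.trans hUA
  have hΦS : AEMeasurable Φ (μ.restrict S) := (hΦ.mono hSA).aemeasurable hS
  have hmap : ∀ B : Set Y, MeasurableSet B →
      Measure.map Φ (μ.restrict S) B = μ (Φ ⁻¹' B ∩ S) := fun B hB ↦ by
    rw [Measure.map_apply_of_aemeasurable hΦS hB, Measure.restrict_apply' hS]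
  have hmeas : ∀ B : Set Y, MeasurableSet B → MeasurableSet (Φ ⁻¹' B ∩ S) := fun B hB ↦ by
    have h : Φ ⁻¹' B ∩ S = (Φ ⁻¹' B ∩ A) ∩ S := by
      rw [inter_assoc, inter_eq_self_of_subset_right hSA]
    rw [h]
    exact (measurableSet_preimage_inter_of_continuousOn hΦ hA hB).inter hS
  have hrestr : ∀ B : Set Y, MeasurableSet B →
      ν.restrict (Φ '' S) B = ν (Φ '' (Φ ⁻¹' B ∩ S)) := fun B hB ↦ by
    rw [Measure.restrict_apply hB, image_preimage_inter]
  have hle₁ : c₁ • Measure.map Φ (μ.restrict S) ≤ ν.restrict (Φ '' S) := by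
    refine Measure.le_iff.2 fun B hB ↦ ?_
    rw [Measure.smul_apply, smul_eq_mul, hmap B hB, hrestr B hB]
    exact (hcomp _ (inter_subset_right.trans hSU) (hmeas B hB)).1
  have hle₂ : ν.restrict (Φ '' S) ≤ c₂ • Measure.map Φ (μ.restrict S) := by
    refine Measure.le_iff.2 fun B hB ↦ ?_
    rw [Measure.smul_apply, smul_eq_mul, hmap B hB, hrestr B hB]
    exact (hcomp _ (inter_subset_right.trans hSU) (hmeas B hB)).2
  have hint : ∫⁻ x, G x ∂(Measure.map Φ (μ.restrict S)) = ∫⁻ y in S, G (Φ y) ∂μ :=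
    lintegral_map' hG.aemeasurable hΦS
  constructor
  · calc c₁ * ∫⁻ y in S, G (Φ y) ∂μ = ∫⁻ x, G x ∂(c₁ • Measure.map Φ (μ.restrict S)) := by
          rw [lintegral_smul_measure, smul_eq_mul, hint]
      _ ≤ ∫⁻ x in Φ '' S, G x ∂ν := lintegral_mono' hle₁ le_rfl
  · calc ∫⁻ x in Φ '' S, G x ∂ν ≤ ∫⁻ x, G x ∂(c₂ • Measure.map Φ (μ.restrict S)) :=
          lintegral_mono' hle₂ le_rfl
      _ = c₂ * ∫⁻ y in S, G (Φ y) ∂μ := by rw [lintegral_smul_measure, smul_eq_mul, hint]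

/-- **Counting the sheets.** If `A = ⋃ S n` with pairwise disjoint `S n ⊆ V n`, `Φ` injective on
each `V n`, the images `Φ(S n)` and `Φ(A)` measurable, and every fibre `Φ⁻¹{Φ y} ∩ A`, `y ∈ A`,
has exactly `k ≠ 0` points, then `∑ₙ ∫⁻_{Φ(S n)} G dν = k ∫⁻_{Φ A} G dν` for measurable `G ≥ 0`:
for `x ∈ Φ(A)` the number of `n` with `x ∈ Φ(S n)` is `#(Φ⁻¹{x} ∩ A) = k`. [folklore] -/
theorem tsum_lintegral_image_pieces {X : Type*} {Y : Type*} [MeasurableSpace Y] (ν : Measure Y)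
    {Φ : X → Y} {A : Set X} {V S : ℕ → Set X} {k : ℕ} (hSV : ∀ n, S n ⊆ V n)
    (hinj : ∀ n, InjOn Φ (V n)) (hdisj : Pairwise (Function.onFun Disjoint S))
    (hSA : ⋃ n, S n = A) (himg : ∀ n, MeasurableSet (Φ '' S n)) (hΦA : MeasurableSet (Φ '' A))
    (hfib : ∀ y ∈ A, (Φ ⁻¹' {Φ y} ∩ A).ncard = k) (hk : k ≠ 0)
    {G : Y → ℝ≥0∞} (hG : Measurable G) :
    ∑' n, ∫⁻ x in Φ '' S n, G x ∂ν = (k : ℝ≥0∞) * ∫⁻ x in Φ '' A, G x ∂ν := by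
  have hSA' : ∀ n, S n ⊆ A := fun n ↦ hSA ▸ subset_iUnion S n
  have hcount : ∀ x, (∑' n, (Φ '' S n).indicator 1 x) * G x =
      (Φ '' A).indicator (fun x ↦ (k : ℝ≥0∞) * G x) x := by
    intro x
    rw [← Literature.Analysis.Calculus.encard_preimage_inter_eq_tsum_indicator hSA'
      hSA.symm.subset hdisj (fun n ↦ (hinj n).mono (hSV n)) x]
    by_cases hx : x ∈ Φ '' A
    · rw [indicator_of_mem hx]
      obtain ⟨y, hy, rfl⟩ := hx
      have hfin : (Φ ⁻¹' {Φ y} ∩ A).Finite :=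
        finite_of_ncard_ne_zero (by rw [hfib y hy]; exact hk)
      rw [← hfin.cast_ncard_eq, hfib y hy, ENat.toENNReal_coe]
    · rw [indicator_of_notMem hx]
      have h0 : Φ ⁻¹' {x} ∩ A = ∅ := eq_empty_of_forall_notMem fun y hy ↦ hx ⟨y, hy.2, hy.1⟩
      simp [h0]
  calc ∑' n, ∫⁻ x in Φ '' S n, G x ∂ν
      = ∑' n, ∫⁻ x, (Φ '' S n).indicator 1 x * G x ∂ν := by
        refine tsum_congr fun n ↦ ?_
        rw [← lintegral_indicator (himg n)]
        refine lintegral_congr fun x ↦ ?_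
        by_cases hx : x ∈ Φ '' S n <;> simp [hx]
    _ = ∫⁻ x, ∑' n, (Φ '' S n).indicator 1 x * G x ∂ν := by
        rw [lintegral_tsum]
        exact fun n ↦ ((measurable_one.indicator (himg n)).mul hG).aemeasurable
    _ = ∫⁻ x, (Φ '' A).indicator (fun x ↦ (k : ℝ≥0∞) * G x) x ∂ν := by
        refine lintegral_congr fun x ↦ ?_
        rw [ENNReal.tsum_mul_right, hcount x]
    _ = ∫⁻ x in Φ '' A, (k : ℝ≥0∞) * G x ∂ν := lintegral_indicator hΦA _
    _ = (k : ℝ≥0∞) * ∫⁻ x in Φ '' A, G x ∂ν := lintegral_const_mul _ hG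

/-- **Area formula with constant multiplicity, comparison form.** Let `Φ : X → Y` be continuous
on `A`, from a Polish space with a measure `μ` to a Hausdorff Borel space with a measure `ν`;
assume every point of `A` has an open neighbourhood `U ⊆ A` on which `Φ` is injective, `Φ(A)`
is measurable, every fibre `Φ⁻¹{Φ y} ∩ A` (`y ∈ A`) has exactly `k ≠ 0` points, and
`c₁ μ S ≤ ν(Φ S) ≤ c₂ μ S` for measurable subsets `S` of open `U ⊆ A` with `Φ` injective on `U`.
Then `c₁ ∫⁻_A G∘Φ dμ ≤ k ∫⁻_{Φ A} G dν ≤ c₂ ∫⁻_A G∘Φ dμ` for every measurable `G ≥ 0`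
(Federer 1969, §3.2.3; Evans–Gariepy Thm. 3.9, locally injective case with constant
multiplicity). [cite: Federer1969, §3.2.3] -/
theorem lintegral_comp_le_and_le {X : Type*} [TopologicalSpace X] [PolishSpace X]
    [MeasurableSpace X] [BorelSpace X] {Y : Type*} [TopologicalSpace Y] [T2Space Y]
    [MeasurableSpace Y] [BorelSpace Y] (μ : Measure X) (ν : Measure Y) {Φ : X → Y} {A : Set X}
    {k : ℕ} {c₁ c₂ : ℝ≥0∞}
    (hk : k ≠ 0) (hΦ : ContinuousOn Φ A)
    (hloc : ∀ y ∈ A, ∃ U : Set X, IsOpen U ∧ y ∈ U ∧ U ⊆ A ∧ InjOn Φ U)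
    (hΦA : MeasurableSet (Φ '' A))
    (hfib : ∀ y ∈ A, (Φ ⁻¹' {Φ y} ∩ A).ncard = k)
    (hcomp : ∀ U ⊆ A, IsOpen U → InjOn Φ U → ∀ S ⊆ U, MeasurableSet S →
      c₁ * μ S ≤ ν (Φ '' S) ∧ ν (Φ '' S) ≤ c₂ * μ S)
    {G : Y → ℝ≥0∞} (hG : Measurable G) :
    c₁ * ∫⁻ y in A, G (Φ y) ∂μ ≤ (k : ℝ≥0∞) * ∫⁻ x in Φ '' A, G x ∂ν ∧
      (k : ℝ≥0∞) * ∫⁻ x in Φ '' A, G x ∂ν ≤ c₂ * ∫⁻ y in A, G (Φ y) ∂μ := by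
  obtain ⟨V, S, hVo, hVA, hVinj, hSV, hSm, hdisj, hSA⟩ := exists_seq_injOn_pieces hloc
  have hA : MeasurableSet A := by rw [← hSA]; exact MeasurableSet.iUnion hSm
  have himg : ∀ n, MeasurableSet (Φ '' S n) := fun n ↦
    (hSm n).image_of_continuousOn_injOn (hΦ.mono ((hSV n).trans (hVA n)))
      ((hVinj n).mono (hSV n))
  have hpiece : ∀ n, c₁ * ∫⁻ y in S n, G (Φ y) ∂μ ≤ ∫⁻ x in Φ '' S n, G x ∂ν ∧
      ∫⁻ x in Φ '' S n, G x ∂ν ≤ c₂ * ∫⁻ y in S n, G (Φ y) ∂μ := fun n ↦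
    lintegral_image_piece_le μ ν hA hΦ (hVA n) (hSV n) (hSm n)
      (hcomp (V n) (hVA n) (hVo n) (hVinj n)) hG
  have hsumA : ∫⁻ y in A, G (Φ y) ∂μ = ∑' n, ∫⁻ y in S n, G (Φ y) ∂μ := by
    rw [← hSA]; exact lintegral_iUnion hSm hdisj _
  have hsumΦ : ∑' n, ∫⁻ x in Φ '' S n, G x ∂ν = (k : ℝ≥0∞) * ∫⁻ x in Φ '' A, G x ∂ν :=
    tsum_lintegral_image_pieces ν hSV hVinj hdisj hSA himg hΦA hfib hk hG
  rw [hsumA, ← hsumΦ, ← ENNReal.tsum_mul_left, ← ENNReal.tsum_mul_left]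
  exact ⟨ENNReal.tsum_le_tsum fun n ↦ (hpiece n).1, ENNReal.tsum_le_tsum fun n ↦ (hpiece n).2⟩

end Multiplicity

/-- **Stub 5 of line `ancient-sphere-rigidity` (r5) — constant-multiplicity integral
comparison.** If `Φ : ℝ⁴ → M` is smooth on the open set `A ⊆ ℝ⁴`, locally injective, with open
image and all fibres over the image of cardinality `k ≥ 1`, and if
`c₁ vol S ≤ Vol_g(Φ S) ≤ c₂ vol S` for measurable subsets `S` of open sets `U ⊆ A` on which `Φ`
is injective, then for every measurable `G ≥ 0` on `M`,
`c₁ ∫_A G∘Φ dy ≤ k ∫_{Φ A} G dV_g ≤ c₂ ∫_A G∘Φ dy`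
(area formula with constant multiplicity, assembled from the injective pieces: partition `A`
into countably many measurable pieces on which `Φ` is injective; on `Φ A` the number of pieces
whose image contains a point is the fibre cardinality `k`;
`Multiplicity.lintegral_comp_le_and_le` with `μ = vol`, `ν = g.riemVolume`).
[cite: Federer1969, §3.2.3] -/
theorem stub_multiplicityLintegral :
    ∀ (M : Type) [TopologicalSpace M] [T2Space M] [SecondCountableTopology M]
      [ChartedSpace (EuclideanSpace ℝ (Fin 4)) M] [IsManifold (𝓡 4) ∞ M]
      [T3Space M] [MeasurableSpace M] [BorelSpace M]
      (g : PseudoRiemannianMetric (𝓡 4) ∞ (EuclideanSpace ℝ (Fin 4)) (TangentSpace (𝓡 4) : M → Type _))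
      (_hg : g.IsRiemannian) (Φ : EuclideanSpace ℝ (Fin 4) → M) (A : Set (EuclideanSpace ℝ (Fin 4)))
      (k : ℕ) (c₁ c₂ : ℝ≥0∞), 1 ≤ k → IsOpen A → ContMDiffOn (𝓡 4) (𝓡 4) ∞ Φ A →
      (∀ y ∈ A, ∃ U : Set (EuclideanSpace ℝ (Fin 4)), IsOpen U ∧ y ∈ U ∧ U ⊆ A ∧ Set.InjOn Φ U) →
      IsOpen (Φ '' A) →
      (∀ y ∈ A, (Φ ⁻¹' {Φ y} ∩ A).ncard = k) →
      (∀ U ⊆ A, IsOpen U → Set.InjOn Φ U → ∀ S ⊆ U, MeasurableSet S →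
        c₁ * volume S ≤ g.riemVolume (Φ '' S) ∧ g.riemVolume (Φ '' S) ≤ c₂ * volume S) →
      ∀ G : M → ℝ≥0∞, Measurable G →
        c₁ * ∫⁻ y in A, G (Φ y) ∂volume ≤ (k : ℝ≥0∞) * ∫⁻ x in Φ '' A, G x ∂g.riemVolume ∧
        (k : ℝ≥0∞) * ∫⁻ x in Φ '' A, G x ∂g.riemVolume ≤ c₂ * ∫⁻ y in A, G (Φ y) ∂volume := by
  intro M _ _ _ _ _ _ _ _ g _hg Φ A k c₁ c₂ hk _hA hΦ hloc hopen hfib hcomp G hG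
  exact Multiplicity.lintegral_comp_le_and_le volume g.riemVolume (Nat.one_le_iff_ne_zero.mp hk)
    hΦ.continuousOn hloc hopen.measurableSet hfib hcomp hG

end Summit.SmoothPoincare4.SmoothPoincare4.Theorems.SubcylindricalRecognition.AncientSphereRigidity

end
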